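import Mathlib
import Summits.Ventures.PercRepro2.Defs
import Summits.Ventures.PercRepro2.Graph
import Summits.Ventures.PercRepro2.Events
import Summits.Ventures.PercRepro2.Independence
import Summits.Ventures.PercRepro2.Exploration
import Summits.Ventures.PercRepro2.PocketConn

/-!
# The pocket law

For a root-only pocket `P` (`PocketConn.IsPocket`) the configuration splits into the pocket edges
`touches ends P` and the outside edges.  The event `Q = {a₁ ↮ a₂}` is the intersection of its
pocket part `Q_P` and its outside part `Q_out` (`conn_roots_iff`), a pocket-determined event is
independent of an outside-determined one (`prob_pocket_mul_outside`), and on `Q` the type of a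
pocket vertex `v` (which root it is attached to) is decided inside the pocket
(`PocketConn.conn_root_iff_conn_restrict`), so that
`P(Q ∩ {r ↔ v} ∩ B_out) = P(Q_P ∩ {v ↔_P r}) · P(Q_out ∩ B_out)` (`prob_Q_root_mul`).
This is Lemma 3 of the root-only-pocket theorem.
-/

namespace Summit.Ventures.PercRepro2

namespace PocketConn

variable {V : Type*} {E : Type*}

/-- **Lemma 1b.**  With both roots outside the pocket, the roots are connected if and only if they
are connected inside the pocket or connected outside it. -/
theorem conn_roots_iff {ends : E → Sym2 V} {ω : Config E} {P : Set V} {a₁ a₂ : V}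
    [DecidablePred (· ∈ touches ends P)] [DecidablePred (· ∈ (touches ends P)ᶜ)]
    (hP : IsPocket ends P a₁ a₂) (h1 : a₁ ∉ P) (h2 : a₂ ∉ P) :
    Conn ends ω a₁ a₂ ↔
      Conn ends (restrict (touches ends P) ω) a₁ a₂ ∨
        Conn ends (restrict (touches ends P)ᶜ ω) a₁ a₂ := by
  constructor
  · intro h
    by_contra hcon
    have hQP : ¬ Conn ends (restrict (touches ends P) ω) a₁ a₂ := fun h' => hcon (Or.inl h')
    have hQ1 : ¬ Conn ends (restrict (touches ends P)ᶜ ω) a₁ a₂ := fun h' => hcon (Or.inr h')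
    set ωP := restrict (touches ends P) ω with hωP
    set ω₁ := restrict (touches ends P)ᶜ ω with hω₁
    have key : a₂ ∈ {z | (z ∉ P ∧ Conn ends ω₁ a₁ z) ∨ (z ∈ P ∧ Conn ends ωP a₁ z)} := by
      refine mem_of_conn_of_closed (ends := ends) (ω := ω) ?_ (Or.inl ⟨h1, conn_refl _ _ _⟩) h
      rintro z hz w hzw
      obtain ⟨_, e, he, hends⟩ := openGraph_adj.1 hzw
      simp only [Set.mem_setOf_eq] at hz ⊢
      rcases hz with ⟨hzP, hzc⟩ | ⟨hzP, hzc⟩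
      · by_cases hwP : w ∈ P
        · rcases hP.other hends hwP with hzP' | rfl | rfl
          · exact absurd hzP' hzP
          · exact Or.inr ⟨hwP, conn_of_openAdj (openAdj_restrict_touches he hends (Or.inr hwP))⟩
          · exact absurd hzc hQ1
        · exact Or.inl ⟨hwP, conn_trans hzc
            (conn_of_openAdj (openAdj_restrict_compl he hends hzP hwP))⟩
      · have hzw' : Conn ends ωP z w :=
          conn_of_openAdj (openAdj_restrict_touches he hends (Or.inl hzP))
        by_cases hwP : w ∈ P
        · exact Or.inr ⟨hwP, conn_trans hzc hzw'⟩
        · rcases hP e z w hends hzP with hwP' | rfl | rfl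
          · exact absurd hwP' hwP
          · exact Or.inl ⟨hwP, conn_refl _ _ _⟩
          · exact absurd (conn_trans hzc hzw') hQP
    simp only [Set.mem_setOf_eq] at key
    rcases key with ⟨_, h'⟩ | ⟨h2', _⟩
    · exact absurd h' hQ1
    · exact absurd h2' h2
  · rintro (h | h)
    · exact conn_mono (restrict_le _ ω) h
    · exact conn_mono (restrict_le _ ω) h

/-- The pocket part of `Q`: the roots are not connected inside the pocket. -/
def QPocket (ends : E → Sym2 V) (P : Set V) [DecidablePred (· ∈ touches ends P)] (a₁ a₂ : V) :
    Set (Config E) :=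
  {ω | ¬ Conn ends (restrict (touches ends P) ω) a₁ a₂}

/-- The outside part of `Q`: the roots are not connected by edges avoiding the pocket. -/
def QOutside (ends : E → Sym2 V) (P : Set V) [DecidablePred (· ∈ (touches ends P)ᶜ)]
    (a₁ a₂ : V) : Set (Config E) :=
  {ω | ¬ Conn ends (restrict (touches ends P)ᶜ ω) a₁ a₂}

/-- `Q = Q_P ∩ Q_out` (event form of Lemma 1b). -/
theorem compl_connEvent_eq_QPocket_inter_QOutside {ends : E → Sym2 V} {P : Set V} {a₁ a₂ : V}
    [DecidablePred (· ∈ touches ends P)] [DecidablePred (· ∈ (touches ends P)ᶜ)]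
    (hP : IsPocket ends P a₁ a₂) (h1 : a₁ ∉ P) (h2 : a₂ ∉ P) :
    (connEvent ends a₁ a₂)ᶜ = QPocket ends P a₁ a₂ ∩ QOutside ends P a₁ a₂ := by
  ext ω
  simp only [Set.mem_compl_iff, mem_connEvent, QPocket, QOutside, Set.mem_inter_iff,
    Set.mem_setOf_eq]
  rw [conn_roots_iff hP h1 h2, not_or]

/-- On `Q`, a pocket vertex attached to neither root has its whole cluster inside the pocket. -/
theorem cluster_subset_of_not_conn_roots {ends : E → Sym2 V} {ω : Config E} {P : Set V}
    {a₁ a₂ : V} (hP : IsPocket ends P a₁ a₂) {v : V} (hv : v ∈ P)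
    (h1 : ¬ Conn ends ω v a₁) (h2 : ¬ Conn ends ω v a₂) : cluster ends ω v ⊆ P := by
  intro z hz
  rw [mem_cluster] at hz
  have key : z ∈ {w | w ∈ P ∧ Conn ends ω v w} := by
    refine mem_of_conn_of_closed (ends := ends) (ω := ω) ?_ ⟨hv, conn_refl _ _ _⟩ hz
    rintro x ⟨hxP, hxc⟩ y hxy
    obtain ⟨_, e, he, hends⟩ := openGraph_adj.1 hxy
    have hxy' : Conn ends ω v y := conn_trans hxc (conn_of_openAdj ⟨e, he, hends⟩)
    rcases hP e x y hends hxP with hyP | rfl | rfl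
    · exact ⟨hyP, hxy'⟩
    · exact absurd hxy' h1
    · exact absurd hxy' h2
  exact key.1

/-- **Cluster of a root on `Q`.**  With both roots outside the pocket, the cluster of a root `r`
is its outside cluster together with the pocket vertices it reaches inside the pocket. -/
theorem cluster_root_eq {ends : E → Sym2 V} {ω : Config E} {P : Set V} {a₁ a₂ : V}
    [DecidablePred (· ∈ touches ends P)] [DecidablePred (· ∈ (touches ends P)ᶜ)]
    (hP : IsPocket ends P a₁ a₂) (hQ : ¬ Conn ends ω a₁ a₂) (h1 : a₁ ∉ P) (h2 : a₂ ∉ P)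
    {r : V} (hr : r = a₁ ∨ r = a₂) :
    cluster ends ω r =
      cluster ends (restrict (touches ends P)ᶜ ω) r ∪
        {v | v ∈ P ∧ Conn ends (restrict (touches ends P) ω) v r} := by
  have hrP : r ∉ P := by rcases hr with rfl | rfl <;> assumption
  ext z
  simp only [mem_cluster, Set.mem_union, Set.mem_setOf_eq]
  constructor
  · intro hz
    by_cases hzP : z ∈ P
    · exact Or.inr ⟨hzP, (conn_root_iff_conn_restrict hP hQ hr hzP).1 hz⟩
    · exact Or.inl ((conn_iff_conn_restrict hP hQ hrP hzP).1 hz)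
  · rintro (hz | ⟨hzP, hz⟩)
    · exact conn_mono (restrict_le _ ω) hz
    · exact conn_symm (conn_mono (restrict_le _ ω) hz)

/-- For `K ⊆ P`, closing the edges touching `P` in the residual graph `G ∖ K` closes exactly
the edges touching `P`. -/
lemma restrict_compl_restrict_compl_of_subset {ends : E → Sym2 V} {K P : Set V}
    [DecidablePred (· ∈ (touches ends K)ᶜ)] [DecidablePred (· ∈ (touches ends P)ᶜ)]
    (hKP : K ⊆ P) (ω : Config E) :
    restrict (touches ends P)ᶜ (restrict (touches ends K)ᶜ ω) =
      restrict (touches ends P)ᶜ ω := by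
  funext e
  by_cases hP' : e ∈ (touches ends P)ᶜ
  · have hK : e ∈ (touches ends K)ᶜ := fun ⟨x, hx, y, hxy⟩ => hP' ⟨x, hKP hx, y, hxy⟩
    rw [restrict_apply_of_mem hP', restrict_apply_of_mem hP', restrict_apply_of_mem hK]
  · rw [restrict_apply_of_notMem hP', restrict_apply_of_notMem hP']

/-- **Lemma 1 in the residual graph `G ∖ K`** (`K ⊆ P`, step (i) of the mean-field bookkeeping):
if the roots are not connected in `G ∖ K`, two vertices outside `P` are connected in `G ∖ K`
if and only if they are connected by edges not touching `P`. -/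
theorem conn_residual_iff {ends : E → Sym2 V} {ω : Config E} {K P : Set V} {a₁ a₂ : V}
    [DecidablePred (· ∈ (touches ends K)ᶜ)] [DecidablePred (· ∈ (touches ends P)ᶜ)]
    (hP : IsPocket ends P a₁ a₂) (hKP : K ⊆ P)
    (hQ : ¬ Conn ends (restrict (touches ends K)ᶜ ω) a₁ a₂) {x y : V} (hx : x ∉ P)
    (hy : y ∉ P) :
    Conn ends (restrict (touches ends K)ᶜ ω) x y ↔
      Conn ends (restrict (touches ends P)ᶜ ω) x y := by
  rw [conn_iff_conn_restrict hP hQ hx hy, restrict_compl_restrict_compl_of_subset hKP]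

section Prob

variable [Fintype E] [DecidableEq E] {R : Type*} [CommRing R]

/-- **Pocket law.**  A pocket-determined event is independent of an outside-determined event. -/
theorem prob_pocket_mul_outside (p : E → R) (ends : E → Sym2 V) (P : Set V)
    [DecidablePred (· ∈ touches ends P)] [DecidablePred (· ∈ (touches ends P)ᶜ)]
    (α β : Config E → Prop) :
    prob p ({ω | α (restrict (touches ends P) ω)} ∩ {ω | β (restrict (touches ends P)ᶜ ω)}) =
      prob p {ω | α (restrict (touches ends P) ω)} *
        prob p {ω | β (restrict (touches ends P)ᶜ ω)} :=
  prob_inter_eq_mul_of_dependsOn_compl p (touches ends P) (dependsOn_restrict _ α)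
    (dependsOn_restrict _ β)

/-- **Lemma 3 (pocket law on `Q`).**  For a root `r` and a pocket vertex `v`, the probability that
`Q` holds, `r ↔ v`, and an outside-determined event `β` holds factors as the pocket probability
`P(Q_P ∩ {v ↔_P r})` times the outside probability `P(Q_out ∩ β)`. -/
theorem prob_Q_root_mul (p : E → R) {ends : E → Sym2 V} {P : Set V} {a₁ a₂ : V}
    [DecidablePred (· ∈ touches ends P)] [DecidablePred (· ∈ (touches ends P)ᶜ)]
    (hP : IsPocket ends P a₁ a₂) (h1 : a₁ ∉ P) (h2 : a₂ ∉ P) {r : V} (hr : r = a₁ ∨ r = a₂)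
    {v : V} (hv : v ∈ P) (β : Config E → Prop) :
    prob p ((connEvent ends a₁ a₂)ᶜ ∩ connEvent ends r v ∩
        {ω | β (restrict (touches ends P)ᶜ ω)}) =
      prob p {ω | ¬ Conn ends (restrict (touches ends P) ω) a₁ a₂ ∧
          Conn ends (restrict (touches ends P) ω) v r} *
        prob p {ω | ¬ Conn ends (restrict (touches ends P)ᶜ ω) a₁ a₂ ∧
          β (restrict (touches ends P)ᶜ ω)} := by
  rw [← prob_pocket_mul_outside p ends P
    (fun σ => ¬ Conn ends σ a₁ a₂ ∧ Conn ends σ v r)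
    (fun σ => ¬ Conn ends σ a₁ a₂ ∧ β σ)]
  congr 1
  ext ω
  simp only [Set.mem_inter_iff, Set.mem_compl_iff, mem_connEvent, Set.mem_setOf_eq]
  constructor
  · rintro ⟨⟨hQ, hrv⟩, hβ⟩
    have hsplit := not_or.1 ((conn_roots_iff (ω := ω) hP h1 h2).not.1 hQ)
    exact ⟨⟨hsplit.1, (conn_root_iff_conn_restrict hP hQ hr hv).1 hrv⟩, ⟨hsplit.2, hβ⟩⟩
  · rintro ⟨⟨hQP, hvr⟩, ⟨hQ1, hβ⟩⟩
    have hQ : ¬ Conn ends ω a₁ a₂ := by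
      rw [conn_roots_iff hP h1 h2]
      exact not_or.2 ⟨hQP, hQ1⟩
    exact ⟨⟨hQ, (conn_root_iff_conn_restrict hP hQ hr hv).2 hvr⟩, hβ⟩

end Prob

end PocketConn

end Summit.Ventures.PercRepro2
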